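import Literature.NumberTheory.EllipticCurves.Rank1Residual.Predicates
import Literature.NumberTheory.EllipticCurves.QuadraticTwistAtTwoMinimalModelProofs
import Literature.NumberTheory.EllipticCurves.IwasawaSelmerSupersingularLocalProofs
import Literature.NumberTheory.EllipticCurves.PrimeConductorTwoTorsionNormalFormProofs
import HarnessLib

/-!
# The `2`-adic dictionary of the supersingular habitat at `2` (route `ResidualThetaTransportAtTwo`,
# crux Kλ⁺ `ResidualThetaMainConjectureAtTwo`, stmt-BirchSwinnertonDyer-20787; child RMC 24195)

Helper file (lead prover bsd-wall-rtt-p2 g7, line `birth`, `--supports` 20787). The crux and its research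
stub (RMC≥) `stub_residualThetaCountLowerAtTwo` live on the HABITAT at `2`: a globally minimal `W / ℚ` with
GOOD SUPERSINGULAR reduction at `2` (`Rank1Residual.GoodSS W 2`: good at `2` and `2 ∣ a₂(W)`). Every road to
(RMC≥) (ROAD B of the crux workfile `RMC-ROADS-g6.md`: Kim–Park / Pollack–Rubin transported to `p = 2` over
`K = ℚ(√Δ_W)`) and the tree's printed `p = 2` transport facts (Matsuno 2008 Thm 4.2 =
`matsuno2008_thm42_transport_two_irreducible` / `_lines`) consume the following elementary `2`-adic facts about
the habitat, proved here once, kernel-checked, in the tree's vocabulary (`integralModelInt`,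
`minimalDiscriminantInt`, `frobeniusTrace`, the hypothesis shapes `2y + a₁x + a₃ ≠ 0` and
`Δ = 4ᵏ·u ⇒ u ≢ 1 (mod 8)` of `LambdaInvariantCongruenceTransportAtTwo`):

* `even_a₁_of_goodSS_two`, `odd_a₃_of_goodSS_two`: on the minimal equation `a₁` is even and `a₃` is odd
  (the reduction mod `2` has an odd number of points, hence `ā₁ = 0` — Silverman A.1.1 —, and good reduction
  forces `a₁` or `a₃` odd);
* `odd_minimalDiscriminantInt_of_hasGoodReductionAtPrime_two`, `minimalDiscriminantInt_emod_eight_of_goodSS_two`: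
  the minimal discriminant is odd, indeed `Δ_W ≡ 5 (mod 8)` — so `Δ_W ∉ ℚ₂^{×2}`, `ℚ₂(√Δ_W) = ℚ₄` is the
  unramified quadratic extension, i.e. **`2` is INERT in `K = ℚ(√Δ_W)`** (the standing hypothesis of the CM
  transport at `2`; `emod_eight_of_minimalDiscriminantInt_eq_sq_mul` gives the same for the square-free kernel);
* `four_pow_mul_emod_eight_ne_one_of_goodSS_two`: the hypothesis shape `∀ k u, W.Δ = 4ᵏ·u → u % 8 ≠ 1` of the
  tree's Matsuno-at-`2` facts, discharged on the habitat;
* `two_mul_add_ne_zero_of_goodSS_two`, `eq_zero_of_two_nsmul_eq_zero_of_goodSS_two`: `W(ℚ)[2] = 0` — no rational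
  point of order `2` (the hypothesis shape `∀ x y, W.Equation x y → 2y + a₁x + a₃ ≠ 0`);
* `not_isSquare_Δ_of_goodSS_two`: `Δ_W` is not a square in `ℚ` (so `Gal(ℚ(W[2])/ℚ) ⊄ A₃`; with `W(ℚ)[2] = 0`
  the image of `ρ̄_{W,2}` is all of `GL₂(𝔽₂) ≅ S₃`).

All statements are about `W` only; nothing here is specific to the CM partner. BSD is not proved by any of this.
-/

set_option autoImplicit false
-- justification: the `Summit.BirchSwinnertonDyer.BirchSwinnertonDyer.…` path repeats a component (route-file convention)
set_option linter.dupNamespace false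

noncomputable section

open scoped Classical

open WeierstrassCurve IsDedekindDomain NumberField Rat.HeightOneSpectrum

namespace Summit.BirchSwinnertonDyer.BirchSwinnertonDyer.Theorems.ResidualThetaHabitatAtTwo

/-! ### Integer Weierstrass equations with `a₁` even and `a₃` odd: `Δ ≡ 5 (mod 8)` -/

/-- For an integral Weierstrass equation with `a₁` even and `a₃` odd, `Δ ≡ 5 (mod 8)`: writing
`b₂ = 4B`, `b₄ = 2C`, `b₆ = 4D + 1` one has `Δ = −16B²b₈ − 64C³ − 27(4D+1)² + 72BC(4D+1) ≡ −27 ≡ 5`.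
[cite: SilvermanAEC2009, III.1 (b₂, b₄, b₆, b₈, Δ)] -/
theorem Δ_emod_eight_of_even_a₁_of_odd_a₃ (M : WeierstrassCurve ℤ) (h₁ : Even M.a₁) (h₃ : Odd M.a₃) :
    M.Δ % 8 = 5 := by
  obtain ⟨s, hs⟩ := h₁
  obtain ⟨t, ht⟩ := h₃
  have hb₂ : M.b₂ = 4 * (s * s + M.a₂) := by simp only [WeierstrassCurve.b₂, hs]; ring
  have hb₄ : M.b₄ = 2 * (M.a₄ + s * (2 * t + 1)) := by simp only [WeierstrassCurve.b₄, hs, ht]; ring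
  have hb₆ : M.b₆ = 4 * (t * t + t + M.a₆) + 1 := by simp only [WeierstrassCurve.b₆, ht]; ring
  have hΔ : M.Δ = 5 + 8 * (-2 * (s * s + M.a₂) ^ 2 * M.b₈ - 8 * (M.a₄ + s * (2 * t + 1)) ^ 3
      - 54 * (t * t + t + M.a₆) ^ 2 - 27 * (t * t + t + M.a₆) - 4
      + 36 * (s * s + M.a₂) * (M.a₄ + s * (2 * t + 1)) * (t * t + t + M.a₆)
      + 9 * (s * s + M.a₂) * (M.a₄ + s * (2 * t + 1))) := by
    rw [WeierstrassCurve.Δ, hb₂, hb₄, hb₆]; ring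
  rw [hΔ, Int.add_mul_emod_self_left]
  rfl

/-- If an integer `Δ ≡ 5 (mod 8)` factors as `Δ = m²·d`, then `d ≡ 5 (mod 8)` as well (`m` is odd, so
`m² ≡ 1 (mod 8)`): the square-free kernel of the minimal discriminant of the habitat is `≡ 5 (mod 8)`, i.e.
`2` is inert in `ℚ(√Δ)`. [folklore] -/
theorem emod_eight_eq_five_of_eq_sq_mul {Δ m d : ℤ} (hΔ : Δ % 8 = 5) (h : Δ = m ^ 2 * d) : d % 8 = 5 := by
  have hm : Odd m := by
    by_contra hm
    rw [Int.not_odd_iff_even] at hm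
    obtain ⟨r, hr⟩ := hm
    have : Δ % 8 = (4 * (r * r * d)) % 8 := by rw [h, hr]; ring_nf
    omega
  obtain ⟨r, hr⟩ := hm
  have hsq : m ^ 2 = 8 * (r * (r + 1) / 2) + 1 := by
    have h2 : (2 : ℤ) ∣ r * (r + 1) := by
      rcases Int.even_or_odd r with ⟨u, hu⟩ | ⟨u, hu⟩
      · exact ⟨u * (r + 1), by rw [hu]; ring⟩
      · exact ⟨r * (u + 1), by rw [hu]; ring⟩
    have := Int.ediv_mul_cancel h2
    rw [hr]; nlinarith [this]
  rw [h, hsq] at hΔ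
  have : (8 * (r * (r + 1) / 2) + 1) * d = d + 8 * ((r * (r + 1) / 2) * d) := by ring
  rw [this, Int.add_mul_emod_self_left] at hΔ
  exact hΔ

/-! ### The habitat: `W / ℚ` globally minimal, good supersingular at `2` -/

variable (W : WeierstrassCurve ℚ) [W.IsGloballyMinimal]

/-- **Good reduction at `2` ⟹ the minimal discriminant is odd**: `W` is minimal at the place `2`, so good
reduction there reads `v₂(Δ_W) = 0` (Silverman VII.5.1(a)). [cite: SilvermanAEC2009, VII.5 Prop. 5.1(a)] -/
theorem odd_minimalDiscriminantInt_of_hasGoodReductionAtPrime_two (hgood : W.HasGoodReductionAtPrime 2) :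
    Odd (minimalDiscriminantInt W) := by
  set v : HeightOneSpectrum (𝓞 ℚ) := (primesEquiv (R := 𝓞 ℚ)).symm ⟨2, Nat.prime_two⟩ with hv
  have hpv : primesEquiv v = ⟨2, Nat.prime_two⟩ := (primesEquiv (R := 𝓞 ℚ)).apply_symm_apply _
  have hgen : natGenerator v = 2 := congrArg Subtype.val hpv
  have hmin : W.IsMinimalAt v := IsGloballyMinimal.isMinimal v
  have hg' : W.HasGoodReductionAt v := by
    have h := W.hasGoodReductionAtPrime_iff_hasGoodReductionAt_ringOfIntegers v
    rw [hpv] at h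
    exact h.mp hgood
  rw [hasGoodReductionAt_iff_of_isMinimalAt hmin, ← cast_minimalDiscriminantInt] at hg'
  rw [← Int.not_even_iff_odd, even_iff_two_dvd]
  intro h2
  -- an integer divisible by `2` has valuation `≤ 2⁻¹ < 1` at the place `2`
  have h1 := Literature.NumberTheory.GaloisRepresentations.Rat.valuation_intCast_le v
    (n := minimalDiscriminantInt W) (e := 1) (by rw [pow_one, hgen]; exact_mod_cast h2)
  rw [hg'] at h1
  have h3 : WithZero.exp (-((1 : ℕ) : ℤ)) < (1 : WithZero (Multiplicative ℤ)) := by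
    rw [← WithZero.exp_zero]; exact WithZero.exp_lt_exp.mpr (by norm_num)
  exact (lt_irrefl _) (lt_of_le_of_lt h1 h3)

/-- **On the habitat `a₁` is even.** The reduction of the minimal equation mod `2` is an elliptic curve over
`𝔽₂` (odd discriminant) with `#W̃(𝔽₂) = 3 − a₂(W)` odd (`2 ∣ a₂`), and over a finite field of
characteristic `2` an odd number of points forces `ā₁ = 0` (otherwise `(ā₃/ā₁, √c)` is a rational point of
order `2`; Silverman A.1.1 / V.3.1(a), tree `a₁_eq_zero_of_odd_natCard_point`).
[cite: SilvermanAEC2009, V.3.1(a), App. A Prop. 1.1] -/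
theorem even_a₁_of_goodSS_two (h : Literature.NumberTheory.EllipticCurves.Rank1Residual.GoodSS W 2) :
    Even (integralModelInt W).a₁ := by
  set M : WeierstrassCurve ℤ := integralModelInt W with hM
  have hΔodd : Odd M.Δ := odd_minimalDiscriminantInt_of_hasGoodReductionAtPrime_two W h.1
  set E : WeierstrassCurve (ZMod 2) := M.map (Int.castRingHom (ZMod 2)) with hE
  haveI : E.IsElliptic := by
    refine ⟨?_⟩
    rw [hE, map_Δ, eq_intCast, isUnit_iff_ne_zero, ne_eq, ZMod.intCast_zmod_eq_zero_iff_dvd]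
    exact fun h2 ↦ (Int.not_even_iff_odd.mpr hΔodd) (even_iff_two_dvd.mpr h2)
  have hodd : Odd (Nat.card E.toAffine.Point) := by
    have h2 : (2 : ℤ) ∣ W.frobeniusTrace 2 := by exact_mod_cast h.2
    rw [WeierstrassCurve.frobeniusTrace] at h2
    have hN : W.reductionPointCount 2 = Nat.card E.toAffine.Point := rfl
    rw [← hN, ← Nat.not_even_iff_odd, ← Int.even_coe_nat]
    rintro ⟨c, hc⟩
    obtain ⟨d, hd⟩ := h2
    push_cast at hd
    omega
  have ha₁ : E.a₁ = 0 := E.a₁_eq_zero_of_odd_natCard_point hodd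
  rw [hE, map_a₁, eq_intCast, ZMod.intCast_zmod_eq_zero_iff_dvd] at ha₁
  exact even_iff_two_dvd.mpr (by exact_mod_cast ha₁)

variable [W.IsElliptic]

/-- **On the habitat `a₃` is odd**: `a₁` is even (`even_a₁_of_goodSS_two`) and good reduction at `2` forces
`a₁` or `a₃` odd (tree `odd_a₁_or_odd_a₃_of_semistableAtTwo`, Silverman VII.5.1).
[cite: SilvermanAEC2009, VII.5 Prop. 5.1] -/
theorem odd_a₃_of_goodSS_two (h : Literature.NumberTheory.EllipticCurves.Rank1Residual.GoodSS W 2) :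
    Odd (integralModelInt W).a₃ :=
  (Literature.NumberTheory.EllipticCurves.odd_a₁_or_odd_a₃_of_semistableAtTwo W (Or.inl h.1)).resolve_left
    (Int.not_odd_iff_even.mpr (even_a₁_of_goodSS_two W h))

/-- **`Δ_W ≡ 5 (mod 8)` on the supersingular habitat at `2`** (minimal discriminant): `a₁` even and `a₃`
odd on the minimal equation. Consequently `Δ_W` is a `2`-adic unit which is not a square in `ℚ₂`, and
`ℚ₂(√Δ_W)` is the UNRAMIFIED quadratic extension: `2` is inert in `K = ℚ(√Δ_W)` (Kurihara–Otsuki 2006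
Prop. 1.1 records the same for `a₂ = 0`). [cite: SilvermanAEC2009, III.1 and VII.5 Prop. 5.1] -/
theorem minimalDiscriminantInt_emod_eight_of_goodSS_two
    (h : Literature.NumberTheory.EllipticCurves.Rank1Residual.GoodSS W 2) :
    minimalDiscriminantInt W % 8 = 5 :=
  Δ_emod_eight_of_even_a₁_of_odd_a₃ (integralModelInt W) (even_a₁_of_goodSS_two W h) (odd_a₃_of_goodSS_two W h)

/-- `W.Δ` (over `ℚ`) is the cast of an integer `≡ 5 (mod 8)` on the habitat. [folklore] -/
theorem exists_Δ_eq_intCast_of_goodSS_two (h : Literature.NumberTheory.EllipticCurves.Rank1Residual.GoodSS W 2) :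
    ∃ D : ℤ, W.Δ = (D : ℚ) ∧ D % 8 = 5 :=
  ⟨minimalDiscriminantInt W, (cast_minimalDiscriminantInt W).symm, minimalDiscriminantInt_emod_eight_of_goodSS_two W h⟩

/-- **The hypothesis shape `Δ = 4ᵏ·u ⇒ u ≢ 1 (mod 8)` of the tree's Matsuno-at-`2` transport facts
(`matsuno2008_thm42_transport_two_irreducible` / `_lines`: "`Δ_W ∉ ℚ₂^{×2}`") holds on the supersingular
habitat** — indeed `Δ_W = 4ᵏ·u` with `u ∈ ℤ` forces `k = 0` and `u = Δ_W ≡ 5 (mod 8)`. [folklore] -/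
theorem four_pow_mul_of_goodSS_two (h : Literature.NumberTheory.EllipticCurves.Rank1Residual.GoodSS W 2)
    (k : ℕ) (u : ℤ) (hu : W.Δ = (4 : ℚ) ^ k * u) : k = 0 ∧ u % 8 = 5 := by
  have h5 := minimalDiscriminantInt_emod_eight_of_goodSS_two W h
  rw [← cast_minimalDiscriminantInt] at hu
  have hZ : minimalDiscriminantInt W = 4 ^ k * u := by exact_mod_cast hu
  rcases Nat.eq_zero_or_pos k with hk | hk
  · subst hk
    rw [pow_zero, one_mul] at hZ
    exact ⟨rfl, hZ ▸ h5⟩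
  · exfalso
    have h4 : (4 : ℤ) ∣ minimalDiscriminantInt W := by
      rw [hZ]; exact (dvd_pow_self 4 hk.ne').mul_right u
    omega

/-- The Matsuno-at-`2` hypothesis shape, verbatim: on the supersingular habitat at `2`,
`∀ k u, W.Δ = 4ᵏ·u → u % 8 ≠ 1`. [folklore] -/
theorem four_pow_mul_emod_eight_ne_one_of_goodSS_two
    (h : Literature.NumberTheory.EllipticCurves.Rank1Residual.GoodSS W 2) :
    ∀ (k : ℕ) (u : ℤ), W.Δ = (4 : ℚ) ^ k * u → u % 8 ≠ 1 := fun k u hu ↦ by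
  have := (four_pow_mul_of_goodSS_two W h k u hu).2
  omega

/-- **`Δ_W` is not a square in `ℚ`** on the supersingular habitat at `2` (an odd square is `≡ 1 (mod 8)`):
the `2`-division field `ℚ(W[2])` contains the quadratic field `ℚ(√Δ_W)`, so `Gal(ℚ(W[2])/ℚ) ⊄ A₃`.
[folklore] -/
theorem not_isSquare_Δ_of_goodSS_two (h : Literature.NumberTheory.EllipticCurves.Rank1Residual.GoodSS W 2) :
    ¬ IsSquare W.Δ := by
  rw [← cast_minimalDiscriminantInt, Rat.isSquare_intCast_iff]
  rintro ⟨m, hm⟩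
  have h5 := minimalDiscriminantInt_emod_eight_of_goodSS_two W h
  have h1 : (1 : ℤ) % 8 = 5 :=
    emod_eight_eq_five_of_eq_sq_mul h5 (by rw [hm]; ring)
  omega

/-- **No rational point of order `2` on the habitat** — the hypothesis shape
`∀ x y, W.Equation x y → 2y + a₁x + a₃ ≠ 0` of the tree's Matsuno-at-`2` facts: a rational point with
`2y + a₁x + a₃ = 0` makes `ξ = 4x` an INTEGER root of `ξ³ + b₂ξ² + 8b₄ξ + 16b₆` (tree
`PrimeConductorTwoTorsion.cubic_eq_zero`, `exists_int_eq_of_cubic`), and for `a₁` even, `a₃` odd that cubic has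
no integer root (tree `no_root_of_even_a₁_odd_a₃`). [cite: SilvermanAEC2009, III.2.3 and VIII.7 (proof of Thm 7.1)] -/
theorem two_mul_add_ne_zero_of_goodSS_two (h : Literature.NumberTheory.EllipticCurves.Rank1Residual.GoodSS W 2) :
    ∀ x y : ℚ, W.toAffine.Equation x y → 2 * y + W.a₁ * x + W.a₃ ≠ 0 := by
  intro x y heq h2
  set M : WeierstrassCurve ℤ := integralModelInt W with hM
  have hWM : M.map (Int.castRingHom ℚ) = W := map_integralModelInt W
  have hc := Literature.NumberTheory.EllipticCurves.PrimeConductorTwoTorsion.cubic_eq_zero W heq h2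
  have hb₂ : W.b₂ = (M.b₂ : ℚ) := by rw [← hWM, map_b₂, eq_intCast]
  have hb₄ : W.b₄ = (M.b₄ : ℚ) := by rw [← hWM, map_b₄, eq_intCast]
  have hb₆ : W.b₆ = (M.b₆ : ℚ) := by rw [← hWM, map_b₆, eq_intCast]
  rw [hb₂, hb₄, hb₆] at hc
  obtain ⟨z, hz⟩ := Literature.NumberTheory.EllipticCurves.PrimeConductorTwoTorsion.exists_int_eq_of_cubic M
    (ξ := 4 * x) (by linear_combination hc)
  rw [← hz] at hc
  have hZ : z ^ 3 + M.b₂ * z ^ 2 + 8 * M.b₄ * z + 16 * M.b₆ = 0 := by exact_mod_cast hc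
  exact Literature.NumberTheory.EllipticCurves.PrimeConductorTwoTorsion.no_root_of_even_a₁_odd_a₃ M
    (even_a₁_of_goodSS_two W h) (odd_a₃_of_goodSS_two W h) z hZ

/-- **`W(ℚ)[2] = 0` on the habitat**: a rational point `P` with `2P = O` is `O` (`P = −P` reads
`2y + a₁x + a₃ = 0` for an affine point, excluded by `two_mul_add_ne_zero_of_goodSS_two`). In particular the
`2`-division cubic of `W` is irreducible over `ℚ` with non-square discriminant: the image of `ρ̄_{W,2}` is all
of `GL₂(𝔽₂) ≅ S₃`. [cite: SilvermanAEC2009, III.2.3] -/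
theorem eq_zero_of_two_nsmul_eq_zero_of_goodSS_two
    (h : Literature.NumberTheory.EllipticCurves.Rank1Residual.GoodSS W 2) (P : W.toAffine.Point)
    (hP : 2 • P = 0) : P = 0 := by
  rcases P with _ | ⟨x, y, hns⟩
  · rfl
  · exfalso
    rw [two_nsmul, add_eq_zero_iff_eq_neg, Affine.Point.neg_some, Affine.Point.some.injEq] at hP
    have hy : y = -y - W.a₁ * x - W.a₃ := hP.2
    exact two_mul_add_ne_zero_of_goodSS_two W h x y hns.left (by linear_combination hy)

end Summit.BirchSwinnertonDyer.BirchSwinnertonDyer.Theorems.ResidualThetaHabitatAtTwo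

end

/-! ## Appended (lead rtt-p2 g7, batch 2): `W(K)[2] = 0` for every number field `K` with `3 ∤ [K : ℚ]`

On the habitat the `2`-division cubic `4x³ + b₂x² + 2b₄x + b₆` has no rational root, hence (degree `3`) is
irreducible over `ℚ`, so any `x`-coordinate of a point of order `2` generates a CUBIC field; a number field of
degree prime to `3` contains none. This is Greenberg–Vatsal's standing hypothesis "`E(ℚ_∞)[p] = 0`" at `p = 2`
for EVERY layer `ℚ_n` of the cyclotomic `ℤ₂`-extension (`[ℚ_n : ℚ] = 2ⁿ`) and for the layers `K·ℚ_n`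
(`K = ℚ(√Δ_W)`, degree `2ⁿ⁺¹`) of ROAD B (`W[2]^{G_{K_∞}} = 0`: the inflation–restriction steps are clean).
-/

noncomputable section

open scoped Classical

open WeierstrassCurve IsDedekindDomain NumberField Rat.HeightOneSpectrum Polynomial

namespace Summit.BirchSwinnertonDyer.BirchSwinnertonDyer.Theorems.ResidualThetaHabitatAtTwo

variable (W : WeierstrassCurve ℚ) [W.IsGloballyMinimal]

/-- **The `2`-division cubic `4x³ + b₂x² + 2b₄x + b₆` has no rational root** when `a₁` is even and `a₃` is odd
on the (integral, globally minimal) equation: a rational root `x` makes `ξ = 4x` an integer root of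
`ξ³ + b₂ξ² + 8b₄ξ + 16b₆` (tree `PrimeConductorTwoTorsion.exists_int_eq_of_cubic`), excluded by
`PrimeConductorTwoTorsion.no_root_of_even_a₁_odd_a₃`. [cite: SilvermanAEC2009, III.2.3 and VIII.7 (proof of Thm 7.1)] -/
theorem twoTorsionCubic_ne_zero_of_even_a₁_of_odd_a₃ (ha₁ : Even (integralModelInt W).a₁)
    (ha₃ : Odd (integralModelInt W).a₃) (x : ℚ) : 4 * x ^ 3 + W.b₂ * x ^ 2 + 2 * W.b₄ * x + W.b₆ ≠ 0 := by
  intro hx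
  set M : WeierstrassCurve ℤ := integralModelInt W with hM
  have hWM : M.map (Int.castRingHom ℚ) = W := map_integralModelInt W
  have hb₂ : W.b₂ = (M.b₂ : ℚ) := by rw [← hWM, map_b₂, eq_intCast]
  have hb₄ : W.b₄ = (M.b₄ : ℚ) := by rw [← hWM, map_b₄, eq_intCast]
  have hb₆ : W.b₆ = (M.b₆ : ℚ) := by rw [← hWM, map_b₆, eq_intCast]
  rw [hb₂, hb₄, hb₆] at hx
  obtain ⟨z, hz⟩ := Literature.NumberTheory.EllipticCurves.PrimeConductorTwoTorsion.exists_int_eq_of_cubic M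
    (ξ := 4 * x) (by linear_combination 16 * hx)
  have hQ : (z : ℚ) ^ 3 + (M.b₂ : ℚ) * (z : ℚ) ^ 2 + 8 * (M.b₄ : ℚ) * z + 16 * (M.b₆ : ℚ) = 0 := by
    rw [hz]; linear_combination 16 * hx
  have hZ : z ^ 3 + M.b₂ * z ^ 2 + 8 * M.b₄ * z + 16 * M.b₆ = 0 := by exact_mod_cast hQ
  exact Literature.NumberTheory.EllipticCurves.PrimeConductorTwoTorsion.no_root_of_even_a₁_odd_a₃ M ha₁ ha₃ z hZ

/-- **`W(K)[2] = 0` over every number field `K` with `3 ∤ [K : ℚ]`**, for `a₁` even and `a₃` odd on the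
minimal equation: a point `(x, y)` of order `2` has `2y + a₁x + a₃ = 0`, so `x` is a root of the monic cubic
`Φ = X³ + (b₂/4)X² + (b₄/2)X + b₆/4 ∈ ℚ[X]`; `Φ` has no rational root
(`twoTorsionCubic_ne_zero_of_even_a₁_of_odd_a₃`), hence is irreducible (degree `3`), so `Φ = minpoly_ℚ(x)` and
`3 = deg Φ ∣ [K : ℚ]`. [cite: SilvermanAEC2009, III.2.3] -/
theorem eq_zero_of_two_nsmul_eq_zero_baseChange_of_even_a₁_of_odd_a₃ (ha₁ : Even (integralModelInt W).a₁)
    (ha₃ : Odd (integralModelInt W).a₃) (K : Type*) [Field K] [NumberField K] (hK : ¬ 3 ∣ Module.finrank ℚ K)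
    (P : (W.baseChange K).toAffine.Point) (hP : 2 • P = 0) : P = 0 := by
  rcases P with _ | ⟨x, y, hns⟩
  · rfl
  · exfalso
    rw [two_nsmul, add_eq_zero_iff_eq_neg, Affine.Point.neg_some, Affine.Point.some.injEq] at hP
    have hy : y = -y - (W.baseChange K).a₁ * x - (W.baseChange K).a₃ := hP.2
    have heq := hns.left
    rw [Affine.equation_iff] at heq
    -- the `2`-division relation over `K`
    have hcub : 4 * x ^ 3 + (W.baseChange K).b₂ * x ^ 2 + 2 * (W.baseChange K).b₄ * x
        + (W.baseChange K).b₆ = 0 := by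
      have h2 : 2 * y + (W.baseChange K).a₁ * x + (W.baseChange K).a₃ = 0 := by linear_combination hy
      simp only [WeierstrassCurve.b₂, WeierstrassCurve.b₄, WeierstrassCurve.b₆]
      linear_combination (2 * y + (W.baseChange K).a₁ * x + (W.baseChange K).a₃) * h2 - 4 * heq
    have e₂ : (W.baseChange K).b₂ = algebraMap ℚ K W.b₂ := W.map_b₂ _
    have e₄ : (W.baseChange K).b₄ = algebraMap ℚ K W.b₄ := W.map_b₄ _
    have e₆ : (W.baseChange K).b₆ = algebraMap ℚ K W.b₆ := W.map_b₆ _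
    rw [e₂, e₄, e₆] at hcub
    -- `x` is a root of the monic cubic `Φ = X³ + (b₂/4)X² + (b₄/2)X + b₆/4 ∈ ℚ[X]`
    set Φ : Cubic ℚ := ⟨1, W.b₂ / 4, W.b₄ / 2, W.b₆ / 4⟩ with hΦ
    have hmonic : Φ.toPoly.Monic := Cubic.monic_of_a_eq_one'
    have hdeg : Φ.toPoly.natDegree = 3 := Cubic.natDegree_of_a_ne_zero' one_ne_zero
    have hx : Polynomial.aeval x Φ.toPoly = 0 := by
      simp only [hΦ, Cubic.toPoly, map_add, map_mul, map_pow, Polynomial.aeval_C, Polynomial.aeval_X,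
        map_one, one_mul, map_div₀]
      have h4 : (algebraMap ℚ K) 4 = 4 := map_ofNat _ 4
      have h2 : (algebraMap ℚ K) 2 = 2 := map_ofNat _ 2
      rw [h4, h2]
      linear_combination hcub / 4
    -- `Φ` has no rational root, hence is irreducible (degree `3`)
    have hirr : Irreducible Φ.toPoly := by
      refine Polynomial.irreducible_of_degree_le_three_of_not_isRoot (by rw [hdeg]; decide) fun q hq ↦ ?_
      have hq' : q ^ 3 + W.b₂ / 4 * q ^ 2 + W.b₄ / 2 * q + W.b₆ / 4 = 0 := by
        simpa [hΦ, Cubic.toPoly] using hq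
      exact twoTorsionCubic_ne_zero_of_even_a₁_of_odd_a₃ W ha₁ ha₃ q (by linear_combination 4 * hq')
    -- so `Φ = minpoly_ℚ(x)` and `3 ∣ [K : ℚ]`
    have hint : IsIntegral ℚ x := ⟨Φ.toPoly, hmonic, by rwa [← Polynomial.aeval_def]⟩
    have hmin : Φ.toPoly = minpoly ℚ x := minpoly.eq_of_irreducible_of_monic hirr hx hmonic
    have hdvd := minpoly.degree_dvd hint
    rw [← hmin, hdeg] at hdvd
    exact hK hdvd

variable [W.IsElliptic]

/-- **On the supersingular habitat at `2` the `2`-division cubic has no rational root.** [folklore] -/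
theorem twoTorsionCubic_ne_zero_of_goodSS_two (h : Literature.NumberTheory.EllipticCurves.Rank1Residual.GoodSS W 2)
    (x : ℚ) : 4 * x ^ 3 + W.b₂ * x ^ 2 + 2 * W.b₄ * x + W.b₆ ≠ 0 :=
  twoTorsionCubic_ne_zero_of_even_a₁_of_odd_a₃ W (even_a₁_of_goodSS_two W h) (odd_a₃_of_goodSS_two W h) x

/-- **`W(K)[2] = 0` on the supersingular habitat at `2`, for every number field `K` with `3 ∤ [K : ℚ]`.**
[cite: SilvermanAEC2009, III.2.3] -/
theorem eq_zero_of_two_nsmul_eq_zero_baseChange_of_goodSS_two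
    (h : Literature.NumberTheory.EllipticCurves.Rank1Residual.GoodSS W 2)
    (K : Type*) [Field K] [NumberField K] (hK : ¬ 3 ∣ Module.finrank ℚ K)
    (P : (W.baseChange K).toAffine.Point) (hP : 2 • P = 0) : P = 0 :=
  eq_zero_of_two_nsmul_eq_zero_baseChange_of_even_a₁_of_odd_a₃ W (even_a₁_of_goodSS_two W h)
    (odd_a₃_of_goodSS_two W h) K hK P hP

/-- **`W(ℚ_n)[2] = 0` and `W(K·ℚ_n)[2] = 0` on the habitat**: Greenberg–Vatsal's hypothesis "`E(ℚ_∞)[p] = 0`" at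
`p = 2` for every number field of `2`-power degree (the layers `ℚ_n` of the cyclotomic `ℤ₂`-extension,
`[ℚ_n : ℚ] = 2ⁿ`, and `ℚ(√Δ_W)·ℚ_n` of degree `2ⁿ⁺¹`). [cite: SilvermanAEC2009, III.2.3] -/
theorem eq_zero_of_two_nsmul_eq_zero_baseChange_of_finrank_eq_two_pow
    (h : Literature.NumberTheory.EllipticCurves.Rank1Residual.GoodSS W 2)
    (K : Type*) [Field K] [NumberField K] (n : ℕ) (hK : Module.finrank ℚ K = 2 ^ n)
    (P : (W.baseChange K).toAffine.Point) (hP : 2 • P = 0) : P = 0 := by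
  refine eq_zero_of_two_nsmul_eq_zero_baseChange_of_goodSS_two W h K ?_ P hP
  rw [hK]
  intro h3
  have := (Nat.Prime.dvd_of_dvd_pow Nat.prime_three h3)
  omega

/-- `2`-power torsion version: on the habitat, `2ᵏ • P = O ⇒ P = O` over every number field of degree prime to
`3` — `W(K)[2^∞] = 0`. [cite: SilvermanAEC2009, III.2.3] -/
theorem eq_zero_of_two_pow_nsmul_eq_zero_baseChange_of_goodSS_two
    (h : Literature.NumberTheory.EllipticCurves.Rank1Residual.GoodSS W 2)
    (K : Type*) [Field K] [NumberField K] (hK : ¬ 3 ∣ Module.finrank ℚ K)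
    (k : ℕ) (P : (W.baseChange K).toAffine.Point) (hP : 2 ^ k • P = 0) : P = 0 := by
  induction k generalizing P with
  | zero => simpa using hP
  | succ k ih =>
    have h2 : 2 • (2 ^ k • P) = 0 := by rw [← mul_nsmul', ← pow_succ', hP]
    exact ih P (eq_zero_of_two_nsmul_eq_zero_baseChange_of_goodSS_two W h K hK _ h2)

end Summit.BirchSwinnertonDyer.BirchSwinnertonDyer.Theorems.ResidualThetaHabitatAtTwo

end
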